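import Summits.BirchSwinnertonDyer.Rank1Residual.Additive.RamifiedSevenGenusStickelbergerDictionary
import Literature.NumberTheory.QuadraticFields.GenusCharacterValues
import Literature.NumberTheory.QuadraticFields.ClassNumberOne
import HarnessLib

set_option autoImplicit false

/-!
# `𝒞₇` genus road (crux `EllipticUnitValueSevenOfGZK`, K7r), the (5)-unit programme (SUMMON GENUS-UNIT-A6), File (A6-2):
# THE EXACT IDENTITY OF GLOBAL UNITS AT LEVEL `n` — `wₙ · c(wₙ) = 1` for `wₙ = (θu n)² · ∏_h (h ξₙ)^{y_h}`, and
# `Uₜ · c(Uₜ) = 1` for every integer exponent `t` (memo S7 (L-n), C2b-β's `hvan` ASSEMBLED; conditional on F5 only)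

Cell bsd-cm, seat bsd-cm-k-ty1 g27 (literature-prover); SUMMON `wake/SUMMON-bsd-cm-k-ty1-20260830T2140Z.md` (planner g36,
D972) block (A6-2).  ASSEMBLY of C2b-β ★★ `twistedUnit_eq_one_of_forall_even` (p790518) with its `hvan` discharged for the
genus exponents: for a value-pinned family `IsNormedEllipticUnitFamily F θu` and a value-pinned Sinnott family `ξu`
(`ξu n = N_{ℚ(ζ_{mₙ})/F′ₙ}(1 − ζ_{mₙ})`, a unit of `F′ₙ` by type),

* §1 `legendreSym_absNorm_eq_one_of_sq_eq_neg_seven` — for `K` with `[K:ℚ] = 2`, `x² = −7` and an ideal `𝔞 ≠ 0` of norm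
  prime to `7`: `(N𝔞/7) = 1` (`ℚ(√−7)` has class number one — tree `isPrincipalIdealRing_of_sq_eq_intCast` — so `[𝔞] = [1]`,
  and Gauss's genus character `𝔞 ↦ (N𝔞/7)` is a class invariant — tree `legendreSym_absNorm_eq_of_mk0_eq`);
  `GenusFrame.jacobiChar_normA_eq_one` — ON THE PIN, `(N𝔞/7) = jacobiChar 7 F.normA = 1` (the one hidden constant of the
  sign audit).
* §2 `reading_transport` — C2b-γ's transport `T` and reading `ψ` compose: `χ(T g) = ψ(g)`; `GenusFrame.normA_coprime_level`.
* §3 ★ `secondFactor_eq_zero_of_pin` — for EVERY character `χ` of `Gal(F′ₙ/ℚ)` killing complex conjugation, the second factor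
  of β's `hvan` vanishes: `2·S_χ(θu n) + (∑ᶠ h, y h·χ(h)⁻¹)·S_χ(ξu n) = 0` (χ = 1: C2b-α; χ ≠ 1: (A6-1) ★★ on ★★★′ with the odd
  partner of (A6-1) §4) — so `hvan` holds for EVERY integer `t`, and δ's trace orthogonality is not needed at level `n`.
* §4 ★★ `exists_twistedGenusUnit_eq_one` — THE EXACT IDENTITY, conditional on F5 only, `(hF5)` FIRST: ONE complex embedding
  `Φ` with its complex conjugation `c` (`Φ ∘ c = conj ∘ Φ`), ONE torsor system `b` (`Φ(ζsys n) = e^{2πi bₙ/mₙ}`), the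
  `Λ`-adic unit `W(b) ≡ C c₀·(1+T)^{r_j(b_j)} (mod h_j)` of C2b-α/File D (any `c₀ ∈ ℤ₇ˣ`), transports
  `T n : (ℤ/mₙ)ˣ →* Gal(F′ₙ/ℚ)` with `σ n g (ζsys n) = (ζsys n)^g`, `T n g = σ n g|_{F′ₙ}`, SUCH THAT for every `n`, with
  `θ = θu n`, `ξ = ξu n`, `y h = ∑ᶠ g, T n g = h, Y_{N𝔞,mₙ,bₙ}(g)` ((A6-1)'s exponent, spelled out), `w = θ²·∏ᶠ h, (h ξ)^{y h}`:
  `w · c(w) = 1` in `ℚ̄` (t-free core) AND `Uₜ · c(Uₜ) = 1` for EVERY `t : Gal(F′ₙ/ℚ) → ℤ`, `Uₜ = ∏ᶠ g, (g w)^{t g}` (the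
  SUMMON's `E₁′ ⋆ ((θu n)²·ξ♯ₙ) = 1` is the instance `t = tr_{ℚ(μ₆)/ℚ}(η₁⁻¹)` on the torsion subgroup).  File E consumes the
  core identity, `b`'s compatibility (C2a §4) and `W`.

HONEST LABEL: conditional theorems (on F5 `Kato2004.kato1551_kroneckerLimitFormula`); no definition, no named fact, no instance;
nothing closes; stmt-BirchSwinnertonDyer-19945 OPEN; K1ᵘ NOT proved (File E = S9 ahead: the push through `globalToSemilocalUnits`
and the readings against `x_spec`/`Θm_spec`/`W`); `X12.CMRamifiedSeven` NOT proved; no summit statement is proved by this seat;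
BSD is claimed for no curve.

## References
* K. Kato, Astérisque 295 (2004) §15.5 (15.5.1) (p. 253), §15.6 (p. 254) [Kato2004Asterisque] — F5 as hypothesis.
* S. Lang, *Cyclotomic Fields I–II* (1990) Ch. 1 §2 FAC 2, Ch. 3 §5 (PDF p. 71) [Lang1990]; L. C. Washington, *Introduction to
  Cyclotomic Fields* (1997) Lemma 1.6, §8.3 [Washington1997]; D. A. Cox, *Primes of the form x² + ny²* (2013) §3.B Thm. 3.15,
  §7.B Thm. 7.7 [Cox2013]; T. Tsuji, J. Number Theory 78 (1999) §6 (p. 20) [Tsuji1999].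
* Tree: (A6-1) (this seat), C2b-α/β/γ (p790322/p790518/p790752), C2a (p790156), C1 (p790011), B3b (p789711), B2a/B2b,
  `QuadraticFields/{GenusCharacterValues,ClassNumberOne}.lean`, `RamifiedSevenGenusNormedFamilyFields.lean`.
-/

noncomputable section

open scoped NumberField ComplexConjugate NumberTheorySymbols nonZeroDivisors
open Field PowerSeries
open Literature.NumberTheory.IwasawaTheory.StickelbergerSeries (layerModulus)
open Literature.NumberTheory.IwasawaTheory.CyclotomicUnits (sinnottNorm)
open Literature.NumberTheory.QuadraticFields (jacobiChar jacobiChar_natCast)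
open Literature.NumberTheory.EllipticCurves (IwasawaAlgebra IsImaginaryQuadratic)
open Literature.NumberTheory.ComplexMultiplication.EllipticUnits

namespace Summit.BirchSwinnertonDyer.Rank1Residual.Additive.GenusSeven

/-! ## §1 The hidden constant `(N𝔞/7) = +1` -/

section Jacobi

variable {K : Type} [Field K] [NumberField K]

/-- **`(N𝔞/7) = 1` for every non-zero ideal `𝔞` of `K = ℚ(√−7)` of norm prime to `7`**: `𝓞_K` is principal (class number
one of `ℚ(√−7)`), so `[𝔞] = [𝓞_K]` in the class group, and `𝔟 ↦ (N𝔟/7)` is constant on ideal classes (Gauss's genus character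
at the ramified prime `7 ∣ d_K = −7`); `(N𝓞_K/7) = (1/7) = 1`.
[cite: Cox2013, §3.B Thm. 3.15 and §7.B Thm. 7.7] [cite: Washington1997, §8.3] -/
theorem legendreSym_absNorm_eq_one_of_sq_eq_neg_seven (hK2 : Module.finrank ℚ K = 2) {s : K} (hs : s ^ 2 = -7)
    {𝔞 : Ideal (𝓞 K)} (h𝔞 : 𝔞 ≠ ⊥) (h7 : ¬ (7 : ℤ) ∣ Ideal.absNorm 𝔞) : legendreSym 7 (Ideal.absNorm 𝔞) = 1 := by
  haveI : Fact (Nat.Prime 7) := ⟨Nat.prime_seven⟩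
  -- class number one
  haveI : IsPrincipalIdealRing (𝓞 K) :=
    Literature.NumberTheory.QuadraticFields.Quadratic.isPrincipalIdealRing_of_sq_eq_intCast hK2 (θ := s) (d := -7)
      (by rw [hs]; push_cast; ring) (by decide)
  haveI : Subsingleton (ClassGroup (𝓞 K)) :=
    Fintype.card_le_one_iff_subsingleton.mp (card_classGroup_eq_one_iff.mpr inferInstance).le
  have h𝔞0 : 𝔞 ∈ (Ideal (𝓞 K))⁰ := mem_nonZeroDivisors_of_ne_zero h𝔞
  have h10 : (⊤ : Ideal (𝓞 K)) ∈ (Ideal (𝓞 K))⁰ := mem_nonZeroDivisors_of_ne_zero (by simp)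
  have h := Literature.NumberTheory.QuadraticFields.Quadratic.legendreSym_absNorm_eq_of_mk0_eq
    (isImaginaryQuadratic_of_sq hK2 hs) (p := 7) (by norm_num) (by rw [discr_eq_neg_seven hK2 hs]; exact ⟨-1, by norm_num⟩) h𝔞0 h10
    (Subsingleton.elim _ _) h7 (by rw [Ideal.absNorm_top]; norm_num)
  rw [h, Ideal.absNorm_top, Nat.cast_one, legendreSym.at_one]

/-- **ON THE PIN: `(N𝔞/7) = jacobiChar 7 F.normA = 1`** — the one hidden constant of the sign audit: `F.normA = N𝔞` for the
pin's twist `𝔞 ⊂ 𝓞_K`, `K ∋ s` with `s² = −7`, `N𝔞 ≥ 2` prime to `7`. [cite: Cox2013, §3.B Thm. 3.15] [cite: Kato2004Asterisque, §15.5 (p. 253, 𝔞 prime to 6p𝔣)] -/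
theorem GenusFrame.jacobiChar_normA_eq_one (F : GenusFrame) {θu : ∀ n : ℕ, globalUnitsOf (F.layer n)}
    (hθu : IsNormedEllipticUnitFamily F θu) : haveI : NeZero (7 : ℕ) := ⟨by norm_num⟩; jacobiChar 7 F.normA = 1 := by
  haveI : Fact (Nat.Prime 7) := ⟨Nat.prime_seven⟩
  obtain ⟨K, _, _, s, ι, e, 𝔣, 𝔞, z, hz, hK2, hs, hN𝔣, h𝔣D, h𝔞, hN𝔞, hcov, hθ⟩ := hθu
  have h𝔞0 : 𝔞 ≠ ⊥ := by
    intro h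
    rw [h, Ideal.absNorm_bot] at hN𝔞
    have := F.two_le_normA
    omega
  have h7 : ¬ (7 : ℤ) ∣ Ideal.absNorm 𝔞 := by
    rw [hN𝔞]
    intro h
    have h' : (7 : ℕ) ∣ F.normA := by exact_mod_cast h
    have h1 := Nat.Coprime.eq_one_of_dvd F.normA_coprime_seven.symm h'
    omega
  have h := legendreSym_absNorm_eq_one_of_sq_eq_neg_seven hK2 hs h𝔞0 h7
  rw [hN𝔞] at h
  rw [jacobiChar_natCast, ← jacobiSym.legendreSym.to_jacobiSym, h, Int.cast_one]

end Jacobi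

/-! ## §2 The transport reads characters -/

section Transport

variable {m : ℕ} [NeZero m] (L : IntermediateField ℚ (AlgebraicClosure ℚ))

/-- **`χ(T g) = ψ(g)`** for C2b-γ's transport (`σ g ζ = ζ^{g.val}`, `T g = σ g|_L`) and a D950 reading `ψ` of `χ` at `ζ`.
[cite: Washington1997, Ch. 3 (pp. 19–21) and Thm. 2.5] -/
theorem reading_transport {ζ : AlgebraicClosure ℚ} {σ : (ZMod m)ˣ → (AlgebraicClosure ℚ ≃ₐ[ℚ] AlgebraicClosure ℚ)}
    {T : (ZMod m)ˣ →* (L ≃ₐ[ℚ] L)} (hσ : ∀ g, σ g ζ = ζ ^ ((g : ZMod m)).val)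
    (hT : ∀ g (x : L), ((T g x : L) : AlgebraicClosure ℚ) = σ g x) {χ : (L ≃ₐ[ℚ] L) →* ℂˣ} {ψ : DirichletCharacter ℂ m}
    (hread : ∀ (τ : AlgebraicClosure ℚ ≃ₐ[ℚ] AlgebraicClosure ℚ) (g : L ≃ₐ[ℚ] L) (a : ℕ),
      (∀ x : L, ((g x : L) : AlgebraicClosure ℚ) = τ x) → τ ζ = ζ ^ a → χ g = ψ a)
    (g : (ZMod m)ˣ) : ((χ (T g) : ℂˣ) : ℂ) = ψ (g : ZMod m) := by
  rw [hread (σ g) (T g) ((g : ZMod m)).val (hT g) (hσ g), ZMod.natCast_zmod_val]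

end Transport

/-- `N𝔞` is prime to every level `mₙ = 7^{n+1}|D|`. [cite: Kato2004Asterisque, §15.5 (p. 253, 𝔞 prime to 6p𝔣)] -/
theorem GenusFrame.normA_coprime_level (F : GenusFrame) (n : ℕ) : F.normA.Coprime (7 ^ (n + 1) * F.d) :=
  Nat.Coprime.mul_right (Nat.Coprime.pow_right _ F.normA_coprime_seven) F.normA_coprime_d

/-! ## §3 The second factor of `hvan` vanishes for EVERY even character -/

section SecondFactor

/-- ★ **THE SECOND FACTOR VANISHES ON THE PIN**: with the data of C2b-α ★ (`Φ`, `b`, the master identity at level `n` for every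
even reading), γ's transport `(σ, T)` at `ζsys n`, and `(N𝔞/7) = 1`: for EVERY character `χ` of `Gal(F′ₙ/ℚ)` with a reading
`ψ` that is EVEN (equivalently `χ(c|_{F′ₙ}) = 1`), `2·S_χ(θu n) + (∑ᶠ h, y h·χ(h)⁻¹)·S_χ(ξu n) = 0`, `y` the fibre sums of
(A6-1)'s exponent at `(N𝔞, mₙ, bₙ)`.  `χ = 1`: both χ-logarithms vanish (units, C2b-α); `χ ≠ 1`: `ψ ≠ 1` is even, (A6-1) §4
gives the odd partner, ★★★′ the master identity, (A6-1) ★★ the cancellation `2·(−½) = −1`.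
[cite: Kato2004Asterisque, §15.5 (15.5.1) (p. 253)] [cite: Lang1990, Ch. 3 §5 (PDF p. 71)] [cite: Washington1997, §8.3] -/
theorem secondFactor_eq_zero_of_pin (F : GenusFrame) (n : ℕ) [NeZero (7 ^ (n + 1) * F.d)]
    (hK : haveI : NeZero (7 : ℕ) := ⟨by norm_num⟩; jacobiChar 7 F.normA = 1)
    {Φ : AlgebraicClosure ℚ →+* ℂ} {b : (ZMod (7 ^ (n + 1) * F.d))ˣ} {θ ξ : F.layer n}
    (hθi : IsIntegral ℤ θ) (hθi' : IsIntegral ℤ θ⁻¹) (hξi : IsIntegral ℤ ξ) (hξi' : IsIntegral ℤ ξ⁻¹)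
    (hmaster : ∀ (ψ : DirichletCharacter ℂ (7 ^ (n + 1) * F.d)), ψ.Even → ψ ≠ 1 →
        ∀ {M : ℕ} [NeZero M] (Ψ : DirichletCharacter ℂ M), (∀ k : ℕ, Ψ k = ψ k * jacobiChar 7 k) → Ψ.Odd →
        ∀ (χ : (F.layer n ≃ₐ[ℚ] F.layer n) →* ℂˣ),
          (∀ (τ : AlgebraicClosure ℚ ≃ₐ[ℚ] AlgebraicClosure ℚ) (g : F.layer n ≃ₐ[ℚ] F.layer n) (a : ℕ),
            (∀ y : F.layer n, ((g y : F.layer n) : AlgebraicClosure ℚ) = τ y) → τ (F.ζsys n) = F.ζsys n ^ a → χ g = ψ a) →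
          ∑ᶠ g : F.layer n ≃ₐ[ℚ] F.layer n, ((χ g : ℂˣ) : ℂ) *
              (Real.log ‖Φ ((g θ : F.layer n) : AlgebraicClosure ℚ)‖ : ℂ) =
            -(1 / 2) * ((F.normA : ℂ) - (ψ F.normA)⁻¹) * ((∑ a : ZMod M, (a.val : ℂ) * Ψ a) / M) * ψ b *
              ∑ᶠ g : F.layer n ≃ₐ[ℚ] F.layer n, ((χ g : ℂˣ) : ℂ) *
                (Real.log ‖Φ ((g ξ : F.layer n) : AlgebraicClosure ℚ)‖ : ℂ))
    {σ : (ZMod (7 ^ (n + 1) * F.d))ˣ → (AlgebraicClosure ℚ ≃ₐ[ℚ] AlgebraicClosure ℚ)}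
    {T : (ZMod (7 ^ (n + 1) * F.d))ˣ →* (F.layer n ≃ₐ[ℚ] F.layer n)}
    (hσ : ∀ g, σ g (F.ζsys n) = F.ζsys n ^ ((g : ZMod (7 ^ (n + 1) * F.d))).val)
    (hT : ∀ g (x : F.layer n), ((T g x : F.layer n) : AlgebraicClosure ℚ) = σ g x)
    (χ : (F.layer n ≃ₐ[ℚ] F.layer n) →* ℂˣ) {ψ : DirichletCharacter ℂ (7 ^ (n + 1) * F.d)}
    (hread : ∀ (τ : AlgebraicClosure ℚ ≃ₐ[ℚ] AlgebraicClosure ℚ) (g : F.layer n ≃ₐ[ℚ] F.layer n) (a : ℕ),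
      (∀ y : F.layer n, ((g y : F.layer n) : AlgebraicClosure ℚ) = τ y) → τ (F.ζsys n) = F.ζsys n ^ a → χ g = ψ a)
    (hψ1 : χ ≠ 1 → ψ ≠ 1) (hψe : ψ.Even) :
    2 * ∑ᶠ g : F.layer n ≃ₐ[ℚ] F.layer n, ((χ g : ℂˣ) : ℂ) * (Real.log ‖Φ ((g θ : F.layer n) : AlgebraicClosure ℚ)‖ : ℂ) +
      (∑ᶠ h : F.layer n ≃ₐ[ℚ] F.layer n,
        ((∑ᶠ (g : (ZMod (7 ^ (n + 1) * F.d))ˣ) (_ : T g = h),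
          J(((((b * g)⁻¹ : (ZMod (7 ^ (n + 1) * F.d))ˣ) : ZMod (7 ^ (n + 1) * F.d)).val : ℤ) | 7) *
            ((F.normA * (((b * g)⁻¹ : (ZMod (7 ^ (n + 1) * F.d))ˣ) : ZMod (7 ^ (n + 1) * F.d)).val /
              (7 ^ (n + 1) * F.d) : ℕ) : ℤ) : ℤ) : ℂ) * ((χ h : ℂˣ) : ℂ)⁻¹) *
        ∑ᶠ g : F.layer n ≃ₐ[ℚ] F.layer n, ((χ g : ℂˣ) : ℂ) * (Real.log ‖Φ ((g ξ : F.layer n) : AlgebraicClosure ℚ)‖ : ℂ) =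
      0 := by
  haveI : Normal ℚ (F.layer n) := F.normal_layer n
  haveI : FiniteDimensional ℚ (F.layer n) := F.finiteDimensional_layer n
  by_cases hχ : χ = 1
  · subst hχ
    rw [logSum_one_character_eq_zero (F.layer n) Φ hθi hθi', logSum_one_character_eq_zero (F.layer n) Φ hξi hξi',
      mul_zero, mul_zero, add_zero]
  · obtain ⟨Ψ, hΨ, hΨo⟩ := exists_oddPartner (Dvd.intro (7 ^ n * F.d) (by ring)) ψ hψe
    exact secondFactor_eq_zero_of_masterIdentity (F.normA_coprime_level n) b _ (fun _ => rfl) ψ Ψ hΨ hK T χ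
      (reading_transport (F.layer n) hσ hT hread) (hmaster ψ hψe (hψ1 hχ) Ψ hΨ hΨo χ hread)

end SecondFactor

/-! ## §4 The exact identity at every level -/

section Identity

/-- ★★ **THE EXACT IDENTITY OF GLOBAL UNITS AT EVERY LEVEL, CONDITIONAL ON F5** (memo S7 (L-n); the SUMMON's (A6-2)).
For `IsNormedEllipticUnitFamily F θu`, a value-pinned Sinnott family `ξu`, and any `c₀ ∈ ℤ₇ˣ`: there are ONE complex
embedding `Φ` with a complex conjugation `c` (`Φ ∘ c = conj ∘ Φ`), ONE torsor system `b` (`Φ(ζsys n) = e^{2πi bₙ/mₙ}`), a unit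
`W ∈ Λˣ` with `W ≡ C c₀·(1+T)^{r_j(b_j)} (mod h_j)` (C2b-α/File D), and transports `T n : (ℤ/mₙ)ˣ →* Gal(F′ₙ/ℚ)` along
automorphisms `σ n g` of `ℚ̄` with `σ n g (ζsys n) = (ζsys n)^g` (C2b-γ), such that for every `n`, writing `θ = θu n`,
`ξ = ξu n ∈ F′ₙ`, `y h = ∑ᶠ g, T n g = h, (c̄/7)·⌊N𝔞·c̄/mₙ⌋` (`c = (bₙ g)⁻¹`; (A6-1)), `w = θ²·∏ᶠ h, (h ξ)^{y h}`:
**`w · c(w) = 1`** in `ℚ̄`, and **`Uₜ · c(Uₜ) = 1`** for EVERY `t : Gal(F′ₙ/ℚ) → ℤ`, `Uₜ = ∏ᶠ g, (g w)^{t g}`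
(C1 ★ + C2b-β ★★ with `hvan` from §3; the η₁-trace `t` of the SUMMON is an instance).
[cite: Kato2004Asterisque, §15.5 (15.5.1) (p. 253) and §15.6 (p. 254)] [cite: Lang1990, Ch. 3 §5 (PDF p. 71)]
[cite: Washington1997, Lemma 1.6 and §8.3] [cite: Tsuji1999, §6 (p. 20)] -/
theorem exists_twistedGenusUnit_eq_one (hF5 : Kato2004.kato1551_kroneckerLimitFormula) (F : GenusFrame)
    {θu : ∀ n : ℕ, globalUnitsOf (F.layer n)} (hθu : IsNormedEllipticUnitFamily F θu)
    (ξu : ∀ n : ℕ, globalUnitsOf (F.layer n))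
    (hξ : ∀ n : ℕ, (((ξu n : globalUnitsOf (F.layer n)) : (AlgebraicClosure ℚ)ˣ) : AlgebraicClosure ℚ) =
      sinnottNorm (t := 7 ^ (n + 1) * F.d) (F.layer n) (F.ζsys n) 1)
    (c₀ : ℤ_[7]ˣ) :
    ∃ (Φ : AlgebraicClosure ℚ →+* ℂ) (c : AlgebraicClosure ℚ ≃ₐ[ℚ] AlgebraicClosure ℚ)
      (b : ∀ n : ℕ, (ZMod (7 ^ (n + 1) * F.d))ˣ) (W : (IwasawaAlgebra 7)ˣ)
      (σ : ∀ n : ℕ, (ZMod (7 ^ (n + 1) * F.d))ˣ → (AlgebraicClosure ℚ ≃ₐ[ℚ] AlgebraicClosure ℚ))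
      (T : ∀ n : ℕ, (ZMod (7 ^ (n + 1) * F.d))ˣ →* (F.layer n ≃ₐ[ℚ] F.layer n)),
      (∀ x : AlgebraicClosure ℚ, Φ (c x) = conj (Φ x)) ∧
      (∀ n : ℕ, Φ (F.ζsys n) =
        Complex.exp (2 * Real.pi * Complex.I / (7 ^ (n + 1) * F.d : ℕ)) ^ ((b n : ZMod (7 ^ (n + 1) * F.d))).val) ∧
      (∀ j : ℕ, (W : IwasawaAlgebra 7) - C (c₀ : ℤ_[7]) * (1 + X) ^ (F.r j ((b j : ZMod (7 ^ (j + 1) * F.d))).val) ∈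
        Ideal.span {layerModulus 7 j}) ∧
      (∀ (n : ℕ) (g : (ZMod (7 ^ (n + 1) * F.d))ˣ), σ n g (F.ζsys n) = F.ζsys n ^ ((g : ZMod (7 ^ (n + 1) * F.d))).val) ∧
      (∀ (n : ℕ) (g : (ZMod (7 ^ (n + 1) * F.d))ˣ) (x : F.layer n),
        ((T n g x : F.layer n) : AlgebraicClosure ℚ) = σ n g x) ∧
      (∀ n : ℕ, Function.Surjective (T n)) ∧
      ∀ n : ℕ,
        ((((toFieldUnits (F.layer n) (θu n) : (F.layer n : Type)ˣ) : F.layer n) ^ 2 *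
            ∏ᶠ h : F.layer n ≃ₐ[ℚ] F.layer n,
              (h ((toFieldUnits (F.layer n) (ξu n) : (F.layer n : Type)ˣ) : F.layer n)) ^
              (∑ᶠ (g : (ZMod (7 ^ (n + 1) * F.d))ˣ) (_ : T n g = h),
              J(((((b n * g)⁻¹ : (ZMod (7 ^ (n + 1) * F.d))ˣ) : ZMod (7 ^ (n + 1) * F.d)).val : ℤ) | 7) *
                ((F.normA * (((b n * g)⁻¹ : (ZMod (7 ^ (n + 1) * F.d))ˣ) : ZMod (7 ^ (n + 1) * F.d)).val /
                  (7 ^ (n + 1) * F.d) : ℕ) : ℤ)) : F.layer n) : AlgebraicClosure ℚ) *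
            c ((((toFieldUnits (F.layer n) (θu n) : (F.layer n : Type)ˣ) : F.layer n) ^ 2 *
              ∏ᶠ h : F.layer n ≃ₐ[ℚ] F.layer n,
                (h ((toFieldUnits (F.layer n) (ξu n) : (F.layer n : Type)ˣ) : F.layer n)) ^
                (∑ᶠ (g : (ZMod (7 ^ (n + 1) * F.d))ˣ) (_ : T n g = h),
                J(((((b n * g)⁻¹ : (ZMod (7 ^ (n + 1) * F.d))ˣ) : ZMod (7 ^ (n + 1) * F.d)).val : ℤ) | 7) *
                  ((F.normA * (((b n * g)⁻¹ : (ZMod (7 ^ (n + 1) * F.d))ˣ) : ZMod (7 ^ (n + 1) * F.d)).val /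
                    (7 ^ (n + 1) * F.d) : ℕ) : ℤ)) : F.layer n) : AlgebraicClosure ℚ) = 1 ∧
        ∀ t : (F.layer n ≃ₐ[ℚ] F.layer n) → ℤ,
          ((∏ᶠ g' : F.layer n ≃ₐ[ℚ] F.layer n,
            (g' (((toFieldUnits (F.layer n) (θu n) : (F.layer n : Type)ˣ) : F.layer n) ^ 2 *
                ∏ᶠ h : F.layer n ≃ₐ[ℚ] F.layer n,
                  (h ((toFieldUnits (F.layer n) (ξu n) : (F.layer n : Type)ˣ) : F.layer n)) ^
                  (∑ᶠ (g : (ZMod (7 ^ (n + 1) * F.d))ˣ) (_ : T n g = h),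
                  J(((((b n * g)⁻¹ : (ZMod (7 ^ (n + 1) * F.d))ˣ) : ZMod (7 ^ (n + 1) * F.d)).val : ℤ) | 7) *
                    ((F.normA * (((b n * g)⁻¹ : (ZMod (7 ^ (n + 1) * F.d))ˣ) : ZMod (7 ^ (n + 1) * F.d)).val /
                      (7 ^ (n + 1) * F.d) : ℕ) : ℤ)))) ^ (t g') : F.layer n) : AlgebraicClosure ℚ) *
            c ((∏ᶠ g' : F.layer n ≃ₐ[ℚ] F.layer n,
              (g' (((toFieldUnits (F.layer n) (θu n) : (F.layer n : Type)ˣ) : F.layer n) ^ 2 *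
                  ∏ᶠ h : F.layer n ≃ₐ[ℚ] F.layer n,
                    (h ((toFieldUnits (F.layer n) (ξu n) : (F.layer n : Type)ˣ) : F.layer n)) ^
                    (∑ᶠ (g : (ZMod (7 ^ (n + 1) * F.d))ˣ) (_ : T n g = h),
                    J(((((b n * g)⁻¹ : (ZMod (7 ^ (n + 1) * F.d))ˣ) : ZMod (7 ^ (n + 1) * F.d)).val : ℤ) | 7) *
                      ((F.normA * (((b n * g)⁻¹ : (ZMod (7 ^ (n + 1) * F.d))ˣ) : ZMod (7 ^ (n + 1) * F.d)).val /
                        (7 ^ (n + 1) * F.d) : ℕ) : ℤ)))) ^ (t g') : F.layer n) : AlgebraicClosure ℚ) = 1 := by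
  classical
  -- the pin's package (C2b-α ★): `Φ`, `b`, `W`, the master identity; B2a: complex conjugation; γ: transports
  obtain ⟨Φ, b, W, hb, hW, hmaster⟩ := exists_artinUnit_of_isNormedEllipticUnitFamily hF5 F hθu
    (fun n => ((toFieldUnits (F.layer n) (ξu n) : (F.layer n : Type)ˣ) : F.layer n))
    (fun n => by rw [coe_coe_toFieldUnits]; exact hξ n) c₀
  obtain ⟨c, hc⟩ := exists_complexConjugation Φ
  have hne : ∀ n : ℕ, NeZero (7 ^ (n + 1) * F.d) := fun n => ⟨(Nat.lt_trans zero_lt_one (F.one_lt_level n)).ne'⟩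
  have hK := F.jacobiChar_normA_eq_one hθu
  have htr : ∀ n : ℕ, ∃ (σ : (ZMod (7 ^ (n + 1) * F.d))ˣ → (AlgebraicClosure ℚ ≃ₐ[ℚ] AlgebraicClosure ℚ))
      (T : (ZMod (7 ^ (n + 1) * F.d))ˣ →* (F.layer n ≃ₐ[ℚ] F.layer n)),
      (∀ g, σ g (F.ζsys n) = F.ζsys n ^ ((g : ZMod (7 ^ (n + 1) * F.d))).val) ∧
      (∀ g (x : F.layer n), ((T g x : F.layer n) : AlgebraicClosure ℚ) = σ g x) ∧ Function.Surjective T := fun n => by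
    haveI := hne n
    haveI : Normal ℚ (F.layer n) := F.normal_layer n
    exact exists_transport (F.isPrimitiveRoot_ζsys n) (F.layer n) (F.layer_le_adjoin_ζsys n)
  choose σ T hσ hT hsurj using htr
  refine ⟨Φ, c, b, W, σ, T, hc, hb, hW, hσ, hT, hsurj, fun n => ?_⟩
  haveI := hne n
  haveI : Normal ℚ (F.layer n) := F.normal_layer n
  haveI : FiniteDimensional ℚ (F.layer n) := F.finiteDimensional_layer n
  -- the data of β at level `n`
  set θ : F.layer n := ((toFieldUnits (F.layer n) (θu n) : (F.layer n : Type)ˣ) : F.layer n) with hθdef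
  set ξ : F.layer n := ((toFieldUnits (F.layer n) (ξu n) : (F.layer n : Type)ˣ) : F.layer n) with hξdef
  have hθi : IsIntegral ℤ θ := isIntegral_toFieldUnits (F.layer n) (θu n)
  have hθi' : IsIntegral ℤ θ⁻¹ := GenusSeven.isIntegral_toFieldUnits_inv (F.layer n) (θu n)
  have hξi : IsIntegral ℤ ξ := isIntegral_toFieldUnits (F.layer n) (ξu n)
  have hξi' : IsIntegral ℤ ξ⁻¹ := GenusSeven.isIntegral_toFieldUnits_inv (F.layer n) (ξu n)
  have hθ0 : θ ≠ 0 := (toFieldUnits (F.layer n) (θu n)).ne_zero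
  have hξ0 : ξ ≠ 0 := (toFieldUnits (F.layer n) (ξu n)).ne_zero
  -- `c` inverts `ζsys n`, so readings of characters killing `c|_{F′ₙ}` are even
  have hζm : F.ζsys n ^ (7 ^ (n + 1) * F.d) = 1 := (F.isPrimitiveRoot_ζsys n).pow_eq_one
  have hcζ : c (F.ζsys n) = (F.ζsys n)⁻¹ := complexConjugation_apply_of_pow_eq_one hc (NeZero.ne _) hζm
  -- `hvan` for every `t`
  have hvan : ∀ (t : (F.layer n ≃ₐ[ℚ] F.layer n) → ℤ) (χ : (F.layer n ≃ₐ[ℚ] F.layer n) →* ℂˣ),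
      χ (c.restrictNormal (F.layer n)) = 1 →
      (∑ᶠ g : F.layer n ≃ₐ[ℚ] F.layer n, (t g : ℂ) * ((χ g : ℂˣ) : ℂ)⁻¹) *
        (2 * ∑ᶠ g : F.layer n ≃ₐ[ℚ] F.layer n, ((χ g : ℂˣ) : ℂ) *
            (Real.log ‖Φ (((g θ : F.layer n)) : AlgebraicClosure ℚ)‖ : ℂ) +
          (∑ᶠ h : F.layer n ≃ₐ[ℚ] F.layer n,
            ((∑ᶠ (g : (ZMod (7 ^ (n + 1) * F.d))ˣ) (_ : T n g = h),
              J(((((b n * g)⁻¹ : (ZMod (7 ^ (n + 1) * F.d))ˣ) : ZMod (7 ^ (n + 1) * F.d)).val : ℤ) | 7) *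
                ((F.normA * (((b n * g)⁻¹ : (ZMod (7 ^ (n + 1) * F.d))ˣ) : ZMod (7 ^ (n + 1) * F.d)).val /
                  (7 ^ (n + 1) * F.d) : ℕ) : ℤ) : ℤ) : ℂ) * ((χ h : ℂˣ) : ℂ)⁻¹) *
            ∑ᶠ g : F.layer n ≃ₐ[ℚ] F.layer n, ((χ g : ℂˣ) : ℂ) *
              (Real.log ‖Φ (((g ξ : F.layer n)) : AlgebraicClosure ℚ)‖ : ℂ)) = 0 := by
    intro t χ hχc
    obtain ⟨ψ, hread, hψ1, hpar⟩ := F.exists_dirichletReading_layer n χ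
    have hψe : ψ.Even := by
      rw [DirichletCharacter.Even, hpar c (c.restrictNormal (F.layer n)) (coe_restrictNormal_apply (F.layer n) c) hcζ, hχc,
        Units.val_one]
    rw [secondFactor_eq_zero_of_pin F n hK hθi hθi' hξi hξi' (hmaster n) (hσ n) (hT n) χ hread hψ1 hψe, mul_zero]
  refine ⟨?_, fun t => ?_⟩
  · -- the core: `t = 𝟙_{g = 1}`
    have h := twistedUnit_eq_one_of_forall_even (F.layer n) (F.layer_aut_comm n) Φ hc hθi hθi' hξi hξi' hθ0 hξ0
      (fun g => if g = 1 then 1 else 0) _ (hvan _)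
    have hsingle : ∀ w : F.layer n, (∏ᶠ g' : F.layer n ≃ₐ[ℚ] F.layer n, (g' w) ^ ((fun g => if g = 1 then (1 : ℤ) else 0) g')) = w := by
      intro w
      rw [finprod_eq_single (fun g' : F.layer n ≃ₐ[ℚ] F.layer n => (g' w) ^ ((fun g => if g = 1 then (1 : ℤ) else 0) g')) 1
        (fun g hg => by simp [hg])]
      simp
    rw [hsingle] at h
    have h' := congrArg (fun x : F.layer n => (x : AlgebraicClosure ℚ)) h
    simpa only [MulMemClass.coe_mul, coe_restrictNormal_apply, OneMemClass.coe_one] using h'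
  · have h := twistedUnit_eq_one_of_forall_even (F.layer n) (F.layer_aut_comm n) Φ hc hθi hθi' hξi hξi' hθ0 hξ0 t _ (hvan t)
    have h' := congrArg (fun x : F.layer n => (x : AlgebraicClosure ℚ)) h
    simpa only [MulMemClass.coe_mul, coe_restrictNormal_apply, OneMemClass.coe_one] using h'

end Identity

end Summit.BirchSwinnertonDyer.Rank1Residual.Additive.GenusSeven

end
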